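import Summits.AtomisticToContinuum.Crystallization.Theorems.PalmUnimodularRigidityLayeredLawsSelectHcpSelectionWord
import HarnessLib

/-!
# Route `ReggeStarCoercivity`, crux `DefectFreeCrystallizes` (stmt-AtomisticToContinuum-13603), line `palm-good-law`:
# definitions for the law-free core `stub_funnelCertificate` — hexagonal / cubic sites on the `1/20`-FUNNEL bond window `(0, 6/5)`

The registered law-free core of the line (`Cruxes/DefectFreeCrystallizes/Lines/palm_good_law.lean`, `stub_funnelCertificate`, lead c7 v22)
asks for a jointly measurable, root-covariant MARK `C ⊆ (configuration, point)`; the intended mark is "the point is a CUBIC site of the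
configuration", read on the bond graph of the charted `1/20`-funnel, whose bonds are the pairs at distance in the OPEN window `(0, 6/5)`
(the window of the landed funnel chart `PalmGoodLaw.FunnelChart.stub_funnelChart`).  Crux 9226's `IsHexSite` / `IsCubicSite`
(`…LayeredLawsSelectHcpSelectionDefs`) read the same combinatorics on the `1 %`-tube window `(0, 28/25]` (closed); on the funnel bonds reach
`1.155`, so the window — and, because of the closed/open endpoint, not merely the scale — must change.  This file is the funnel copy of that
vocabulary, verbatim up to the window, plus the mark as a subset of `Measure E3 × E3`:

* `Bond65 S x y` — `x, y ∈ S`, `0 < dist x y < 6/5`;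
* `IsHexSite65 S x` / `IsCubicSite65 S x` — two link triangles sharing a link edge (anticuboctahedral site) / its negation on a point of `S`;
* `cubicMark65` — `{(μ, y) | IsCubicSite65 (pts μ) y}`, the mark fed to `stub_covariantMecke` / `stub_funnelCertificate`.

All definitions are route-internal bookkeeping (`[folklore]`); the one theorem (`bond65_symm`) is the anchor.
-/

noncomputable section

namespace Summit.AtomisticToContinuum.Crystallization.Theorems.PalmGoodLaw.FunnelSites

open MeasureTheory Set
open Summit.AtomisticToContinuum.Crystallization.Theorems.PalmUnimodularRigidity.LayeredLawsSelectHcp (pts)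

/-- Euclidean `3`-space. [folklore] -/
local notation "E3" => EuclideanSpace ℝ (Fin 3)

/-- The BOND relation of a configuration `S` on the `1/20`-funnel: two points of `S` at distance in the OPEN window `(0, 6/5)` (the bond
window of the landed funnel chart; in a Barlow-charted configuration these are exactly the images of the touching pairs of the ideal
stacking). Symmetric, irreflexive, translation-covariant. [folklore] -/
def Bond65 (S : Set E3) (x y : E3) : Prop :=
  x ∈ S ∧ y ∈ S ∧ 0 < dist x y ∧ dist x y < 6 / 5

/-- `x` is a HEXAGONAL (hcp-like, anticuboctahedral) site of `S` on the funnel window: some bonded pair `p ~ q` of neighbours of `x` has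
TWO distinct common neighbours `t, b` that are also neighbours of `x` (two link triangles sharing the link edge `pq`; in the cuboctahedron
every link edge lies in exactly one triangle).  Verbatim `LayeredLawsSelectHcp.IsHexSite` with `Bond65`. [folklore] -/
def IsHexSite65 (S : Set E3) (x : E3) : Prop :=
  ∃ p q t b : E3, t ≠ b ∧ Bond65 S x p ∧ Bond65 S x q ∧ Bond65 S x t ∧ Bond65 S x b ∧ Bond65 S p q ∧
    Bond65 S t p ∧ Bond65 S t q ∧ Bond65 S b p ∧ Bond65 S b q

/-- `x` is a CUBIC (fcc-like, cuboctahedral) site of `S` on the funnel window — a stacking fault passes through `x`: a point of `S` that is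
not hexagonal.  Verbatim `LayeredLawsSelectHcp.IsCubicSite` with `Bond65`. [folklore] -/
def IsCubicSite65 (S : Set E3) (x : E3) : Prop :=
  x ∈ S ∧ ¬ IsHexSite65 S x

/-- **The cubic mark** of the law-free core: the set of pairs (configuration, point) such that the point is a cubic site of the atoms of
the configuration, on the funnel window.  Intended instance of the mark `C` of `stub_funnelCertificate` / `stub_covariantMecke`
(root-covariant: `(θ_y μ, −y) ∈ cubicMark65 ↔ (μ, 0) ∈ cubicMark65`, since translations are isometries). [folklore] -/
def cubicMark65 : Set (Measure E3 × E3) := {p | IsCubicSite65 (pts p.1) p.2}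

/-- Bonds are symmetric (anchor of this definitions file). [folklore] -/
theorem bond65_symm : ∀ (S : Set E3) (x y : E3), Bond65 S x y → Bond65 S y x := by
  intro S x y h
  obtain ⟨hx, hy, h0, h1⟩ := h
  rw [dist_comm] at h0 h1
  exact ⟨hy, hx, h0, h1⟩

/-- Definitional unfolding of the mark. [folklore] -/
theorem mem_cubicMark65_iff (μ : Measure E3) (y : E3) : (μ, y) ∈ cubicMark65 ↔ IsCubicSite65 (pts μ) y := Iff.rfl


/-! ## Isometry invariance and ROOT COVARIANCE of the cubic mark (dev copy; to land as …FunnelSitesCovariance.lean importing the Defs) -/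

/-- Bonds are carried by isometries. [folklore] -/
theorem bond65_image_iff {f : E3 → E3} (hf : Isometry f) (S : Set E3) (u v : E3) :
    Bond65 (f '' S) (f u) (f v) ↔ Bond65 S u v := by
  simp only [Bond65, hf.injective.mem_set_image, hf.dist_eq]

/-- Hexagonal sites are carried by isometries. [folklore] -/
theorem isHexSite65_image_iff {f : E3 → E3} (hf : Isometry f) (S : Set E3) (x : E3) :
    IsHexSite65 (f '' S) (f x) ↔ IsHexSite65 S x := by
  constructor
  · rintro ⟨p, q, t, b, htb, hxp, hxq, hxt, hxb, hpq, htp, htq, hbp, hbq⟩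
    obtain ⟨p, -, rfl⟩ := hxp.2.1
    obtain ⟨q, -, rfl⟩ := hxq.2.1
    obtain ⟨t, -, rfl⟩ := hxt.2.1
    obtain ⟨b, -, rfl⟩ := hxb.2.1
    rw [bond65_image_iff hf] at hxp hxq hxt hxb hpq htp htq hbp hbq
    exact ⟨p, q, t, b, fun h => htb (congrArg f h), hxp, hxq, hxt, hxb, hpq, htp, htq, hbp, hbq⟩
  · rintro ⟨p, q, t, b, htb, hxp, hxq, hxt, hxb, hpq, htp, htq, hbp, hbq⟩
    refine ⟨f p, f q, f t, f b, fun h => htb (hf.injective h), ?_⟩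
    simp only [bond65_image_iff hf]
    exact ⟨hxp, hxq, hxt, hxb, hpq, htp, htq, hbp, hbq⟩

/-- Cubic sites are carried by isometries. [folklore] -/
theorem isCubicSite65_image_iff {f : E3 → E3} (hf : Isometry f) (S : Set E3) (x : E3) :
    IsCubicSite65 (f '' S) (f x) ↔ IsCubicSite65 S x := by
  rw [IsCubicSite65, IsCubicSite65, isHexSite65_image_iff hf, hf.injective.mem_set_image]

/-- Translation covariance of the cubic-site predicate: the root of the configuration re-rooted at `y` is cubic iff `y` is a cubic site.
[folklore] -/
theorem isCubicSite65_image_sub_zero_iff (S : Set E3) (y : E3) :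
    IsCubicSite65 ((fun z : E3 => z - y) '' S) 0 ↔ IsCubicSite65 S y := by
  have h := isCubicSite65_image_iff (Isometry.of_dist_eq fun a b : E3 => dist_sub_right a b y) S y
  rwa [sub_self] at h

/-- The atoms of a re-rooted configuration: `pts (θ_y μ) = pts μ − y` for EVERY measure `μ`. [folklore] -/
theorem pts_map_sub (μ : Measure E3) (y : E3) :
    pts (Measure.map (fun z : E3 => z - y) μ) = (fun z : E3 => z - y) '' pts μ := by
  ext z
  simp only [pts, Set.mem_setOf_eq, Set.mem_image]
  rw [Measure.map_apply (measurable_sub_const y) (measurableSet_singleton z)]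
  have hpre : (fun z : E3 => z - y) ⁻¹' {z} = {z + y} := by
    ext u
    simp only [Set.mem_preimage, Set.mem_singleton_iff]
    constructor
    · intro h; rw [← h, sub_add_cancel]
    · intro h; rw [h, add_sub_cancel_right]
  rw [hpre]
  constructor
  · intro h; exact ⟨z + y, h, add_sub_cancel_right z y⟩
  · rintro ⟨u, hu, rfl⟩; rwa [sub_add_cancel]

/-- **Root covariance of the cubic mark** (the covariance conjunct of `stub_funnelCertificate` / hypothesis of `stub_covariantMecke` for the
intended mark): `(θ_y μ, −y) ∈ cubicMark65 ↔ (μ, 0) ∈ cubicMark65` for every measure `μ` and point `y`. [folklore] -/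
theorem cubicMark65_covariant (μ : Measure E3) (y : E3) :
    (Measure.map (fun z : E3 => z - y) μ, -y) ∈ cubicMark65 ↔ (μ, (0 : E3)) ∈ cubicMark65 := by
  rw [mem_cubicMark65_iff, mem_cubicMark65_iff, pts_map_sub]
  -- re-root at `y` twice: `0` cubic in `S − y` iff `y` cubic in `S`; and `-y` cubic in `S − y` iff ... use the isometry `z ↦ z - y`
  have h1 := isCubicSite65_image_iff (Isometry.of_dist_eq fun a b : E3 => dist_sub_right a b y) (pts μ) 0
  rw [zero_sub] at h1
  exact h1

/-! ## The site type under a funnel chart is the local Hägg pattern (port of 9226's `isHexSite_chart_iff` to the window `(0, 6/5)`) -/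

section Chart

open Literature.MathematicalPhysics.StatisticalMechanics
open Summit.AtomisticToContinuum.Crystallization.Theorems.PalmUnimodularRigidity.LayeredLawsSelectHcp
  (shellModel_cubic fst_of_mem_shellOffsets dist_eq_one_iff_shellAdj mem_shellOffsets_of_dist_eq_one ShellAdj shellOffsets)

variable {s : ℤ → ℤ} {S : Set E3} {Φ : E3 → E3}

/-- Under a funnel chart, bonds of `S` between chart images of lattice sites are exactly the touching pairs of the ideal stacking.
[folklore] -/
theorem bond65_chart_iff (hbij : Set.BijOn Φ (barlowStacking 1 (Real.sqrt (2 / 3)) s) S)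
    (hiso : ∀ p ∈ barlowStacking 1 (Real.sqrt (2 / 3)) s, ∀ q ∈ barlowStacking 1 (Real.sqrt (2 / 3)) s,
      (dist p q = 1 ↔ (0 < dist (Φ p) (Φ q) ∧ dist (Φ p) (Φ q) < 6 / 5)))
    (k₁ i₁ j₁ k₂ i₂ j₂ : ℤ) :
    Bond65 S (Φ (barlowPos 1 (Real.sqrt (2 / 3)) s k₁ i₁ j₁)) (Φ (barlowPos 1 (Real.sqrt (2 / 3)) s k₂ i₂ j₂)) ↔
      dist (barlowPos 1 (Real.sqrt (2 / 3)) s k₁ i₁ j₁) (barlowPos 1 (Real.sqrt (2 / 3)) s k₂ i₂ j₂) = 1 := by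
  rw [hiso _ (barlowPos_mem _ _ _) _ (barlowPos_mem _ _ _)]
  exact ⟨fun h => h.2.2, fun h => ⟨hbij.mapsTo (barlowPos_mem _ _ _), hbij.mapsTo (barlowPos_mem _ _ _), h⟩⟩

/-- **The site type is the local Hägg pattern (funnel window).**  For a charted `S` with chart `(s, Φ)` (bond window `(0, 6/5)`), the image
of the lattice site `(k, i, j)` is a HEXAGONAL site of `S` iff `s k = -s (k-1)`.  Verbatim port of 9226's `isHexSite_chart_iff`. [folklore] -/
theorem isHexSite65_chart_iff (hs : IsHaggSeq s)
    (hbij : Set.BijOn Φ (barlowStacking 1 (Real.sqrt (2 / 3)) s) S)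
    (hiso : ∀ p ∈ barlowStacking 1 (Real.sqrt (2 / 3)) s, ∀ q ∈ barlowStacking 1 (Real.sqrt (2 / 3)) s,
      (dist p q = 1 ↔ (0 < dist (Φ p) (Φ q) ∧ dist (Φ p) (Φ q) < 6 / 5)))
    (k i j : ℤ) :
    IsHexSite65 S (Φ (barlowPos 1 (Real.sqrt (2 / 3)) s k i j)) ↔ s k = -s (k - 1) := by
  constructor
  · rintro ⟨p, q, t, b, htb, hxp, hxq, hxt, hxb, hpq, htp, htq, hbp, hbq⟩
    by_contra hne
    have hsk : s k = s (k - 1) := by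
      rcases hs k with h | h <;> rcases hs (k - 1) with h' | h' <;> omega
    obtain ⟨p, hpB, rfl⟩ := hbij.surjOn hxp.2.1
    obtain ⟨q, hqB, rfl⟩ := hbij.surjOn hxq.2.1
    obtain ⟨t, htB, rfl⟩ := hbij.surjOn hxt.2.1
    obtain ⟨b, hbB, rfl⟩ := hbij.surjOn hxb.2.1
    obtain ⟨kp, ip, jp, rfl⟩ := hpB
    obtain ⟨kq, iq, jq, rfl⟩ := hqB
    obtain ⟨kt, it, jt, rfl⟩ := htB
    obtain ⟨kb, ib, jb, rfl⟩ := hbB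
    simp only [bond65_chart_iff hbij hiso] at hxp hxq hxt hxb hpq htp htq hbp hbq
    have mp := mem_shellOffsets_of_dist_eq_one hs hxp
    have mq := mem_shellOffsets_of_dist_eq_one hs hxq
    have mt := mem_shellOffsets_of_dist_eq_one hs hxt
    have mb := mem_shellOffsets_of_dist_eq_one hs hxb
    rw [dist_eq_one_iff_shellAdj s k i j (fst_of_mem_shellOffsets mp) (fst_of_mem_shellOffsets mq)]
      at hpq
    rw [dist_eq_one_iff_shellAdj s k i j (fst_of_mem_shellOffsets mt) (fst_of_mem_shellOffsets mp)]
      at htp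
    rw [dist_eq_one_iff_shellAdj s k i j (fst_of_mem_shellOffsets mt) (fst_of_mem_shellOffsets mq)]
      at htq
    rw [dist_eq_one_iff_shellAdj s k i j (fst_of_mem_shellOffsets mb) (fst_of_mem_shellOffsets mp)]
      at hbp
    rw [dist_eq_one_iff_shellAdj s k i j (fst_of_mem_shellOffsets mb) (fst_of_mem_shellOffsets mq)]
      at hbq
    rw [hsk] at mp mq mt mb hpq htp htq hbp hbq
    have key := shellModel_cubic (hs (k - 1)) _ mp _ mq hpq _ mt htp htq _ mb hbp hbq
    simp only [Prod.mk.injEq] at key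
    obtain ⟨e1, e2, e3⟩ := key
    exact htb (by rw [show kt = kb by omega, show it = ib by omega, show jt = jb by omega])
  · intro hk
    obtain ⟨σ, hσ, h1, h2⟩ : ∃ σ : ℤ, (σ = 1 ∨ σ = -1) ∧ s (k - 1) = σ ∧ s k = -σ :=
      ⟨s (k - 1), hs (k - 1), rfl, hk⟩
    have hx : barlowPos 1 (Real.sqrt (2 / 3)) s k i j =
        barlowPos 1 (Real.sqrt (2 / 3)) s (k + 0) (i + 0) (j + 0) := by simp only [add_zero]
    rw [hx]
    have D : ∀ {dk₁ di₁ dj₁ dk₂ di₂ dj₂ : ℤ}, (dk₁ = -1 ∨ dk₁ = 0 ∨ dk₁ = 1) →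
        (dk₂ = -1 ∨ dk₂ = 0 ∨ dk₂ = 1) → ShellAdj σ (-σ) (dk₁, di₁, dj₁) (dk₂, di₂, dj₂) →
        Bond65 S (Φ (barlowPos 1 (Real.sqrt (2 / 3)) s (k + dk₁) (i + di₁) (j + dj₁)))
          (Φ (barlowPos 1 (Real.sqrt (2 / 3)) s (k + dk₂) (i + di₂) (j + dj₂))) := by
      intro dk₁ di₁ dj₁ dk₂ di₂ dj₂ e₁ e₂ hadj
      rw [bond65_chart_iff hbij hiso,
        dist_eq_one_iff_shellAdj s k i j (k₁ := k + dk₁) (k₂ := k + dk₂) (by simpa using e₁)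
          (by simpa using e₂)]
      simpa [h1, h2] using hadj
    refine ⟨Φ (barlowPos 1 (Real.sqrt (2 / 3)) s (k + 0) (i + -σ) (j + 0)),
      Φ (barlowPos 1 (Real.sqrt (2 / 3)) s (k + 0) (i + 0) (j + -σ)),
      Φ (barlowPos 1 (Real.sqrt (2 / 3)) s (k + 1) (i + 0) (j + 0)),
      Φ (barlowPos 1 (Real.sqrt (2 / 3)) s (k + -1) (i + 0) (j + 0)), ?_,
      D (by omega) (by omega) (by rcases hσ with rfl | rfl <;> decide),
      D (by omega) (by omega) (by rcases hσ with rfl | rfl <;> decide),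
      D (by omega) (by omega) (by rcases hσ with rfl | rfl <;> decide),
      D (by omega) (by omega) (by rcases hσ with rfl | rfl <;> decide),
      D (by omega) (by omega) (by rcases hσ with rfl | rfl <;> decide),
      D (by omega) (by omega) (by rcases hσ with rfl | rfl <;> decide),
      D (by omega) (by omega) (by rcases hσ with rfl | rfl <;> decide),
      D (by omega) (by omega) (by rcases hσ with rfl | rfl <;> decide),
      D (by omega) (by omega) (by rcases hσ with rfl | rfl <;> decide)⟩
    intro heq
    have h3 := congrArg (fun v : E3 => v 2)
      (hbij.injOn (barlowPos_mem _ _ _) (barlowPos_mem _ _ _) heq)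
    simp only [barlowPos_apply_two] at h3
    have hH : (0 : ℝ) < Real.sqrt (2 / 3) := Real.sqrt_pos.2 (by norm_num)
    have h4 : ((k + 1 : ℤ) : ℝ) = ((k + -1 : ℤ) : ℝ) := mul_right_cancel₀ hH.ne' h3
    have h5 : (k + 1 : ℤ) = k + -1 := by exact_mod_cast h4
    omega

/-- **Cubic sites under a funnel chart**: the image of the lattice site `(k, i, j)` is a CUBIC site of `S` iff `s k = s (k - 1)` (a stacking
fault passes through layer `k`). [folklore] -/
theorem isCubicSite65_chart_iff (hs : IsHaggSeq s)
    (hbij : Set.BijOn Φ (barlowStacking 1 (Real.sqrt (2 / 3)) s) S)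
    (hiso : ∀ p ∈ barlowStacking 1 (Real.sqrt (2 / 3)) s, ∀ q ∈ barlowStacking 1 (Real.sqrt (2 / 3)) s,
      (dist p q = 1 ↔ (0 < dist (Φ p) (Φ q) ∧ dist (Φ p) (Φ q) < 6 / 5)))
    (k i j : ℤ) :
    IsCubicSite65 S (Φ (barlowPos 1 (Real.sqrt (2 / 3)) s k i j)) ↔ s k = s (k - 1) := by
  rw [IsCubicSite65, isHexSite65_chart_iff hs hbij hiso]
  constructor
  · rintro ⟨-, hne⟩
    rcases hs k with h | h <;> rcases hs (k - 1) with h' | h' <;> omega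
  · intro hk
    refine ⟨hbij.mapsTo (barlowPos_mem _ _ _), fun h => ?_⟩
    rcases hs k with h1 | h1 <;> omega

end Chart


end Summit.AtomisticToContinuum.Crystallization.Theorems.PalmGoodLaw.FunnelSites

end
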